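/-
Copyright: statement-level skeleton of a published paper (lit-balaban cell, Phase-2 proof seat p13, gen 8). No proof
claims beyond what the kernel checks below.
-/
import Literature.MathematicalPhysics.QuantumFieldTheory.BalabanImbrieJaffe1984to88.BIJ88TraceTermsBound579
import Literature.MathematicalPhysics.QuantumFieldTheory.BalabanImbrieJaffe1984to88.BIJ88Sect5StatementsPart2
import Literature.MathematicalPhysics.QuantumFieldTheory.BalabanImbrieJaffe1984to88.BIJ88Ineq579Second

/-!
# `BalabanImbrieJaffe1984to88.BIJ88Ineq579First` — T. Bałaban, J. Imbrie, A. Jaffe, *Effective action and cluster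
properties of the abelian Higgs model*, Commun. Math. Phys. **114** (1988) 257–315 [BalabanImbrieJaffe1988]: Sect. 5.7,
p. 291 — **THE FIRST INEQUALITY OF (5.7.9)**, *"|W^{(j)′}(X)| ≤ e_j^{n̄+1−α} e^{−cr(e_k)|X|^−} (r(e_k)L^{k−j})^d |X|"*,
PROVED for the localized trace terms `W′(X)` of (5.7.4) built in `BIJ88TraceTerms579`: the `e_j`-ORDERS of the `W`-letters,
the sum over the length `l` (convergent), the printed shape with `|X|^−`, and — under the displayed constants hypothesis —
the first conjunct of r16's leaf `BIJ88Sect5StatementsPart2.Ineq579` for this `W′`; plus the localization of the whole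
exponent of (5.7.4) (file 3/3; 1/3 = `BIJ88TraceTerms579`, 2/3 = `BIJ88TraceTermsBound579`)

statement-level skeleton of published theorems with citation tags; proofs where landed; nothing here is a claim about the Yang–Mills mass gap

PDF held: `paper:balaban1988-cmp114-bij-abelian-higgs-effective-action` (journal page = PDF page + 256); pp. 289–291
[PDF 33–35] read as IMAGES (CCITT renders; copies `HOME/lit-balaban-p13/pages/`).

CITATION HEADER (lean-in-tree rule).  Part of the lit-balaban TYPED SKELETON (HOME `run/shared/lean/pub/lit-balaban/`):
WHAT IS REPRODUCED = row **C2.Eq5.7.7-5.7.9** of `HOME/lit-balaban-r16/ROWS-C2-part2.md`, member *(5.7.9), first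
inequality* (so far `typed`: r16's leaf `Ineq579`, first conjunct; the second inequality is p36's
`BIJ88Ineq579Second.ineq579_second`); unit `lit-balaban-p13` (gen 8), owner r16, referee ref-5.  Built BY NAME on
`BIJ88TraceTerms579` / `BIJ88TraceTermsBound579`, r16's `BIJ88Sect5StatementsPart2` (`PolymerSys`, `cardMinus`,
`exp_card_le_exp_cardMinus`); p02's `BIJ88TraceLog574.hasSum_eq574` ((5.7.4) as a convergent series in the same norm) is the
series whose terms are regrouped (`tsum_trace_terms_eq`; cited, not imported).  Nothing restated.

## The print (p. 289 [PDF 33] and p. 291 [PDF 35], verbatim)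

(5.7.4): *"Thus the determinant can be expanded as exp[Σ_{l=1}^{∞} (1/2l) tr(C^{(j)}_{Λ₁₀^{(j)}}(u_{k+1})W^{(j)})^l]."*
p. 289: *"The operator C^{(j)}_{Λ₁₀^{(j)}}(u_{k+1}) is our first encounter with nonlocal effects. To treat it we apply the
generalized random walk expansion (2.45), modified slightly to use cubes of size L^{k−j}r(e_k) in T_{L^{−j}}. We need a
similar expansion for W^{(j)} into terms defined in regions X with appropriate decay estimates."*  p. 291: *"In the
expansion (5.7.4) we put W^{(j)} = W^{(j,n̄)} + Σ_X W^{(j)}(X). In terms with l ≤ n̄ we separate from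
(1/2l) tr(C^{(j)}_{Λ₁₀^{(j)}}(u_{k+1})W^{(j,n̄)}) the terms of order ≤ n̄ in e_j. […] These will be treated carefully by a
resummation. In the other terms we insert the expansion for C^{(j)}_{Λ₁₀^{(j)}}(u_{k+1}); they then take the form
Σ_X W^{(j)′}(X), with  |W^{(j)′}(X)| ≤ e_j^{n̄+1−α} e^{−cr(e_k)|X|^−} (r(e_k)L^{k−j})^d |X| ≤ e_j^κ e^{−cr(e_k)|X|^−}. (5.7.9)
We can take κ arbitrarily large by increasing n̄. The high power of e_j beats the big factor (r(e_k)L^{k−j})^d, the volume of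
an elementary cube measured on the j-th scale. This is to account for one free summation on T₁^{(j)}; all but one such
summation is controlled by exponential decay on the j-th scale."*  p. 294: *"As always, X is a connected union of
L^{k−j}r(e_k)-cubes, and W^{(j)(iv)}(X) has dependence only on fields in X, X̄, or B_{k−j}(X)."*

## What is kernel-checked here

* **`abs_wlen_le_graded`** — *"Each term in W^{(j)} has at least one factor e_j"* (p. 289), *"Terms whose order in e_j … is
  between 1 and n̄ are considered as part of −W^{(j,n̄)}. Terms of higher order … are grouped into … W^{(j)}(X)"* (p. 290):
  with `W`-letters graded by `deg b ≥ 1`, `‖W_b‖ ≤ ε^{deg b}·w_b` (`0 ≤ ε ≤ 1`; print `ε = e_j`), a selection `S` keeping only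
  words of total degree `≥ m` gives `|wlen l S X| ≤ s|X|·ε^{max(m,l)}·e^{−κ|X|}·(N_κ(C)N_κ(w))^l`.
* `Wprime` (= `W^{(j)′}(X) := Σ_{l≥1}(1/2l)·wlen l (S l) X`), `K579`, `tsum_graded_majorant_le`, **`summable_Wprime`** — with
  `θ = N_κ(C)N_κ(w)` and `ρ = εθ < 1` (*"bounded by a very small number"*, p. 289) the length series converges absolutely and
  `|W′(X)| ≤ ε^m·K·s|X|·e^{−κ|X|}`, `K = Σ_{l=1}^{m} θ^l/(2l) + ρθ^m/(2(m+1)(1−ρ))` EXPLICIT.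
* **`abs_Wprime_le_printed`** — the PRINTED SHAPE with `m = n̄+1`, `κ = c·r(e_k)`, `s ≤ (r(e_k)L^{k−j})^d`,
  `|X|^−` = r16's `cardMinus` on the cube polymers `cubePolymers`:
  `|W′(X)| ≤ (ε^{n̄+1}K)·e^{−cr(e_k)|X|^−}·(r(e_k)L^{k−j})^d·|X|`; **`ineq579_first`** — under the constants hypothesis
  `ε^{n̄+1}K ≤ e_j^{n̄+1−α}`, verbatim the FIRST CONJUNCT of `Ineq579 (cubePolymers ι) W′ e_j r(e_k) L^{k−j} d n̄ α κ c`.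
* **`ineq579_chain`** (v1.1, §8) — THE WHOLE PRINTED CHAIN of (5.7.9) for the constructed `W′` at r18's running charges
  (2.2)/(2.3): `ineq579_first` followed by p36's `BIJ88Ineq579Second.ineq579_second` (second rate `c/2`, `κ` explicit; the empty
  cube set handled by the first inequality itself): `|W′(X)| ≤ e_j^κ·e^{−(c/2)r(e_k)|X|^−}` for EVERY cube set `X`.
* **`abs_Wprime_le_of_decay`** (v1.2, §9) — the rooted-sum hypotheses DISCHARGED from the printed-shape decay of the pieces
  ((2.46)/(5.7.7)-block: aggregate `K·λ^{|X|}` per support, supports `R`-connected, `(Δ₀+1)²·2λe^{κ} ≤ ½`) via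
  `BIJ88TraceTermsBound579.rooted_sum_le_of_decay`: the printed shape holds with `N_C = 4K_Cλ_Ce^κ`, `N_w = 4K_Wλ_We^κ`.
* **`tsum_trace_terms_eq`** — with all words of length `> n̄` selected, the exponent of (5.7.4),
  `Σ_{l≥1}(1/2l)tr((CW)^l)` for `C = Σ_a C_a`, `W = Σ_b W_b`, EQUALS `Σ_X W′(X) + ` (the finitely many unselected low-order terms,
  regrouped by hull) — *"they then take the form Σ_X W^{(j)′}(X)"*.

HONEST SCOPE.  (i) Letters, supports, decay, `e_j`-orders are INPUTS in the displayed shapes ((2.45)–(2.46), (5.7.7)-block,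
p. 289); nothing of Sects. 2–5 is constructed.  (ii) The print's single exponent `e_j^{n̄+1−α}` is obtained as `ε^{n̄+1}·K`, `K`
explicit in the rooted sums (`θ` may exceed `1`; the print's `e_j^{−α}` absorbs such field-bound sizes — generic-constant
convention, cf. GAPS G-C2-p36-03); the identification `ε^{n̄+1}K ≤ e_j^{n̄+1−α}` is a displayed hypothesis of `ineq579_first`,
not derived.  (iii) The low-order terms are only SEPARATED (selection `¬S`), not resummed ((5.7.10)–(5.7.12), other rows).
Theorems only (the definitions `Wprime`, `K579`, `cubePolymers` live in `BIJ88TraceTerms579`); no `Prop` facts; axioms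
standard.  Version log: v1 = p301001 (§§5–7 + example); v1.1 = §8 `ineq579_chain` appended (imports p36's `BIJ88Ineq579Second`),
every v1 declaration byte-identical; v1.2 = §9 `abs_Wprime_le_of_decay` appended, every v1.1 declaration byte-identical.
-/

namespace Literature.MathematicalPhysics.QuantumFieldTheory.BalabanImbrieJaffe1984to88.BIJ88Ineq579First

open Finset
open Literature.MathematicalPhysics.QuantumFieldTheory.Balaban1983to89.B4RandomWalk213
  (bprod bprod_zero bprod_succ bprod_cons bprod_one sum_pow_eq_sum_bprod sum_tuple_succ)
open Literature.Probability.LatticeModels (IsRConnected)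
open BIJ88TraceTerms579 BIJ88TraceTermsBound579
open scoped Matrix Matrix.Norms.Operator

variable {T ι A B : Type*} [Fintype T] [DecidableEq T] [Fintype ι] [DecidableEq ι]
  [Fintype A] [DecidableEq A] [Fintype B] [DecidableEq B]

/-! ## §5 The `e_j`-orders of the `W`-letters and the sum over `l`: `W^{(j)′}(X)` -/

section Orders

variable {cube : T → ι} {Cl : A → Matrix T T ℝ} {sC : A → Finset ι} {Wl : B → Matrix T T ℝ} {sW : B → Finset ι}

omit [Fintype ι] [DecidableEq A] [DecidableEq B] in
/-- **THE FIRST INEQUALITY OF (5.7.9), PER LENGTH, WITH THE `e_j`-ORDERS** — *"Each term in W^{(j)} has at least one factor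
e_j"* (p. 289), *"Terms whose order in e_j … is between 1 and n̄ are considered as part of −W^{(j,n̄)}. Terms of higher
order … are grouped into … W^{(j)}(X)"* (p. 290): grade the `W`-letters by `deg b ≥ 1` with `‖W_b‖ ≤ ε^{deg b}·w_b`
(`0 ≤ ε ≤ 1`; print: `ε = e_j`, `w_b` the field-bound part).  If the selection `S` only keeps words of total degree
`Σ_i deg b_i ≥ m` (*"the other terms"*, order `> n̄`: `m = n̄+1`), then
`|wlen l S X| ≤ s·|X|·ε^{max(m,l)}·e^{−κ|X|}·(N_κ(C)N_κ(w))^l`. [cite: BalabanImbrieJaffe1988, (5.7.9) p.291] -/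
theorem abs_wlen_le_graded
    (hCs : ∀ a x y, Cl a x y ≠ 0 → cube x ∈ sC a ∧ cube y ∈ sC a)
    (hWs : ∀ b x y, Wl b x y ≠ 0 → cube x ∈ sW b ∧ cube y ∈ sW b)
    {s : ℕ} (hs : ∀ c : ι, (Finset.univ.filter fun x => cube x = c).card ≤ s)
    {κ : ℝ} (hκ : 0 ≤ κ) (deg : B → ℕ) (hdeg : ∀ b, 1 ≤ deg b) {ε : ℝ} (hε0 : 0 ≤ ε) (hε1 : ε ≤ 1)
    (wB : B → ℝ) (hwB : ∀ b, 0 ≤ wB b) (hWle : ∀ b, ‖Wl b‖ ≤ ε ^ deg b * wB b) {NC Nw : ℝ}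
    (hNC : ∀ c : ι, ∑ a, (if c ∈ sC a then ‖Cl a‖ * Real.exp (κ * (sC a).card) * (sC a).card else 0) ≤ NC)
    (hNw : ∀ c : ι, ∑ b, (if c ∈ sW b then wB b * Real.exp (κ * (sW b).card) * (sW b).card else 0) ≤ Nw)
    (l : ℕ) (S : (Fin (l + 1) → A × B) → Prop) [DecidablePred S] {m : ℕ} (hS : ∀ w, S w → m ≤ ∑ i, deg (w i).2)
    (X : Finset ι) :
    |wlen Cl sC Wl sW (l + 1) S X| ≤
      s * X.card * (ε ^ max m (l + 1) * (Real.exp (-(κ * X.card)) * (NC * Nw) ^ (l + 1))) := by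
  rcases X.eq_empty_or_nonempty with rfl | ⟨c₀, -⟩
  · have : wlen Cl sC Wl sW (l + 1) S ∅ = 0 := by
      unfold wlen
      refine Finset.sum_eq_zero fun w hw => ?_
      rw [Finset.mem_filter] at hw
      by_contra hne
      obtain ⟨x, -, hx⟩ := Finset.exists_ne_zero_of_sum_ne_zero hne
      have := cube_mem_hull_of_bprod_apply_ne_zero (sW := sW) hCs l w hx
      rw [hw.2.1] at this
      exact Finset.notMem_empty _ this
    rw [this]; simp
  have hNC0 : 0 ≤ NC := le_trans (Finset.sum_nonneg fun a _ => ite_nonneg (mul_nonneg (mul_nonneg (norm_nonneg _)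
      (Real.exp_nonneg _)) (Nat.cast_nonneg _)) le_rfl) (hNC c₀)
  have hNw0 : 0 ≤ Nw := le_trans (Finset.sum_nonneg fun b _ => ite_nonneg (mul_nonneg (mul_nonneg (hwB _)
      (Real.exp_nonneg _)) (Nat.cast_nonneg _)) le_rfl) (hNw c₀)
  have hG0 : ∀ w : Fin (l + 1) → A × B, 0 ≤ ∏ i, (‖Cl (w i).1‖ * wB (w i).2) :=
    fun w => Finset.prod_nonneg fun i _ => mul_nonneg (norm_nonneg _) (hwB _)
  refine abs_wlen_le_of_majorant hCs hWs hs l S X (F := fun w => ε ^ max m (l + 1) * ∏ i, (‖Cl (w i).1‖ * wB (w i).2))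
    (fun w => mul_nonneg (pow_nonneg hε0 _) (hG0 w)) (fun w hw => ?_)
    (mul_nonneg (pow_nonneg hε0 _) (mul_nonneg (Real.exp_nonneg _) (pow_nonneg (mul_nonneg hNC0 hNw0) _))) ?_
  · -- ‖word‖ ≤ Π ‖C‖‖W‖ ≤ Π ‖C‖ε^{deg}w = ε^{Σ deg}·Π ‖C‖w ≤ ε^{max(m,l+1)}·Π ‖C‖w
    have hsum_ge : max m (l + 1) ≤ ∑ i, deg (w i).2 := by
      refine max_le (hS w hw) ?_
      calc l + 1 = ∑ _i : Fin (l + 1), 1 := by simp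
        _ ≤ ∑ i, deg (w i).2 := Finset.sum_le_sum fun i _ => hdeg _
    calc ‖bprod (letter Cl Wl) (l + 1) w‖ ≤ ∏ i, (‖Cl (w i).1‖ * ‖Wl (w i).2‖) := norm_bprod_le l w
      _ ≤ ∏ i, (‖Cl (w i).1‖ * (ε ^ deg (w i).2 * wB (w i).2)) :=
          Finset.prod_le_prod (fun i _ => mul_nonneg (norm_nonneg _) (norm_nonneg _))
            fun i _ => mul_le_mul_of_nonneg_left (hWle _) (norm_nonneg _)
      _ = ε ^ (∑ i, deg (w i).2) * ∏ i, (‖Cl (w i).1‖ * wB (w i).2) := by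
          rw [← Finset.prod_pow_eq_pow_sum, ← Finset.prod_mul_distrib]
          exact Finset.prod_congr rfl fun i _ => by ring
      _ ≤ ε ^ max m (l + 1) * ∏ i, (‖Cl (w i).1‖ * wB (w i).2) :=
          mul_le_mul_of_nonneg_right (pow_le_pow_of_le_one hε0 hε1 hsum_ge) (hG0 w)
  · intro x _
    have hpull : ∀ w : Fin (l + 1) → A × B,
        (if hull sC sW (l + 1) w = X ∧ LinkedFrom sC sW {cube x} (l + 1) w
          then ε ^ max m (l + 1) * ∏ i, (‖Cl (w i).1‖ * wB (w i).2) else 0) =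
        ε ^ max m (l + 1) * (if hull sC sW (l + 1) w = X ∧ LinkedFrom sC sW {cube x} (l + 1) w
          then ∏ i, (‖Cl (w i).1‖ * wB (w i).2) else 0) := by
      intro w; split_ifs <;> simp
    rw [Finset.sum_congr rfl fun w _ => hpull w, ← Finset.mul_sum]
    exact mul_le_mul_of_nonneg_left
      (sum_hull_linkedFrom_le (fun a => norm_nonneg (Cl a)) hwB hκ hNC hNw (l + 1) (cube x) X) (pow_nonneg hε0 _)

omit [Fintype T] [DecidableEq T] [Fintype ι] [DecidableEq ι] [Fintype A] [DecidableEq A] [Fintype B] [DecidableEq B] in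
/-- `K ≥ 0` for `θ ≥ 0`, `0 ≤ ρ < 1`. [cite: BalabanImbrieJaffe1988, (5.7.9) p.291] -/
theorem K579_nonneg {θ ρ : ℝ} (hθ : 0 ≤ θ) (hρ0 : 0 ≤ ρ) (hρ1 : ρ < 1) (m : ℕ) : 0 ≤ K579 θ ρ m := by
  unfold K579
  refine add_nonneg (Finset.sum_nonneg fun l _ => by positivity) ?_
  have : 0 < 1 - ρ := by linarith
  positivity

omit [Fintype T] [DecidableEq T] [Fintype ι] [DecidableEq ι] [Fintype A] [DecidableEq A] [Fintype B] [DecidableEq B] in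
/-- the length sum of the graded majorants: `c_l := ε^{max(m,l+1)}θ^{l+1}/(2(l+1))` is summable and
`Σ_l c_l ≤ ε^m·K` for `ε, θ ≥ 0`, `εθ < 1` (the length sum behind *"We can take κ arbitrarily large by increasing n̄"*:
the smallness is `ε^m`, `m = n̄ + 1`). [cite: BalabanImbrieJaffe1988, (5.7.9) p.291] -/
theorem tsum_graded_majorant_le {ε θ : ℝ} (hε0 : 0 ≤ ε) (hθ : 0 ≤ θ) (hρ : ε * θ < 1) (m : ℕ) :
    Summable (fun l : ℕ => ε ^ max m (l + 1) * θ ^ (l + 1) / (2 * ((l : ℝ) + 1))) ∧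
      ∑' l : ℕ, ε ^ max m (l + 1) * θ ^ (l + 1) / (2 * ((l : ℝ) + 1)) ≤ ε ^ m * K579 θ (ε * θ) m := by
  set c : ℕ → ℝ := fun l => ε ^ max m (l + 1) * θ ^ (l + 1) / (2 * ((l : ℝ) + 1)) with hc
  have hρ0 : 0 ≤ ε * θ := mul_nonneg hε0 hθ
  -- the tail `l ↦ c (l + m)` is dominated by a geometric sequence
  have htail_le : ∀ l, c (l + m) ≤ (ε * θ) ^ (m + 1) / (2 * ((m : ℝ) + 1)) * (ε * θ) ^ l := by
    intro l
    have hmax : max m (l + m + 1) = l + m + 1 := max_eq_right (by omega)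
    have hεθ : ε ^ (l + m + 1) * θ ^ (l + m + 1) = (ε * θ) ^ (m + 1) * (ε * θ) ^ l := by
      rw [← mul_pow, ← pow_add]
      congr 1
      ring
    have h1 : (2 * ((l : ℝ) + m + 1))⁻¹ ≤ (2 * ((m : ℝ) + 1))⁻¹ := by
      apply inv_anti₀ (by positivity)
      linarith [(Nat.cast_nonneg l : (0 : ℝ) ≤ l)]
    simp only [hc, hmax, Nat.cast_add]
    rw [div_eq_mul_inv, hεθ]
    calc (ε * θ) ^ (m + 1) * (ε * θ) ^ l * (2 * ((l : ℝ) + m + 1))⁻¹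
        ≤ (ε * θ) ^ (m + 1) * (ε * θ) ^ l * (2 * ((m : ℝ) + 1))⁻¹ :=
          mul_le_mul_of_nonneg_left h1 (by positivity)
      _ = (ε * θ) ^ (m + 1) / (2 * ((m : ℝ) + 1)) * (ε * θ) ^ l := by ring
  have hc0 : ∀ l, 0 ≤ c l := fun l => by simp only [hc]; positivity
  have htail_summ : Summable fun l => c (l + m) :=
    Summable.of_nonneg_of_le (fun l => hc0 _) htail_le ((summable_geometric_of_lt_one hρ0 hρ).mul_left _)
  have hsumm : Summable c := (summable_nat_add_iff m).1 htail_summ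
  refine ⟨hsumm, ?_⟩
  rw [← hsumm.sum_add_tsum_nat_add m]
  -- the finitely many `l < m`: `max m (l+1) = m`
  have hfin : ∑ l ∈ Finset.range m, c l = ε ^ m * ∑ l ∈ Finset.range m, θ ^ (l + 1) / (2 * ((l : ℝ) + 1)) := by
    rw [Finset.mul_sum]
    refine Finset.sum_congr rfl fun l hl => ?_
    rw [Finset.mem_range] at hl
    have hmax : max m (l + 1) = m := max_eq_left (by omega)
    simp only [hc, hmax]
    exact mul_div_assoc _ _ _
  have htail : ∑' l, c (l + m) ≤ ε ^ m * ((ε * θ) * θ ^ m / (2 * ((m : ℝ) + 1) * (1 - ε * θ))) := by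
    calc ∑' l, c (l + m) ≤ ∑' l, (ε * θ) ^ (m + 1) / (2 * ((m : ℝ) + 1)) * (ε * θ) ^ l :=
          htail_summ.tsum_le_tsum htail_le ((summable_geometric_of_lt_one hρ0 hρ).mul_left _)
      _ = (ε * θ) ^ (m + 1) / (2 * ((m : ℝ) + 1)) * (1 - ε * θ)⁻¹ := by
          rw [tsum_mul_left, tsum_geometric_of_lt_one hρ0 hρ]
      _ = ε ^ m * ((ε * θ) * θ ^ m / (2 * ((m : ℝ) + 1) * (1 - ε * θ))) := by
          rw [pow_succ, mul_pow, div_eq_mul_inv, div_eq_mul_inv, mul_inv (2 * ((m : ℝ) + 1)) (1 - ε * θ)]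
          ring
  rw [hfin, K579, mul_add]
  exact add_le_add le_rfl htail

omit [Fintype ι] [DecidableEq A] [DecidableEq B] in
/-- **`W^{(j)′}` CONVERGES** — under the graded hypotheses of `abs_wlen_le_graded` and the smallness
`ε·N_κ(C)N_κ(w) < 1` (*"the operator after the identity is bounded by a very small number"*, p. 289), the length series
defining `W′(X)` is absolutely convergent. [cite: BalabanImbrieJaffe1988, (5.7.4) p.289, (5.7.9) p.291] -/
theorem summable_Wprime
    (hCs : ∀ a x y, Cl a x y ≠ 0 → cube x ∈ sC a ∧ cube y ∈ sC a)
    (hWs : ∀ b x y, Wl b x y ≠ 0 → cube x ∈ sW b ∧ cube y ∈ sW b)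
    {s : ℕ} (hs : ∀ c : ι, (Finset.univ.filter fun x => cube x = c).card ≤ s)
    {κ : ℝ} (hκ : 0 ≤ κ) (deg : B → ℕ) (hdeg : ∀ b, 1 ≤ deg b) {ε : ℝ} (hε0 : 0 ≤ ε) (hε1 : ε ≤ 1)
    (wB : B → ℝ) (hwB : ∀ b, 0 ≤ wB b) (hWle : ∀ b, ‖Wl b‖ ≤ ε ^ deg b * wB b) {NC Nw : ℝ} (hNC0 : 0 ≤ NC) (hNw0 : 0 ≤ Nw)
    (hNC : ∀ c : ι, ∑ a, (if c ∈ sC a then ‖Cl a‖ * Real.exp (κ * (sC a).card) * (sC a).card else 0) ≤ NC)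
    (hNw : ∀ c : ι, ∑ b, (if c ∈ sW b then wB b * Real.exp (κ * (sW b).card) * (sW b).card else 0) ≤ Nw)
    (hρ : ε * (NC * Nw) < 1)
    (S : (l : ℕ) → (Fin (l + 1) → A × B) → Prop) [∀ l, DecidablePred (S l)] {m : ℕ}
    (hS : ∀ l w, S l w → m ≤ ∑ i, deg (w i).2) (X : Finset ι) :
    Summable (fun l : ℕ => 1 / (2 * ((l : ℝ) + 1)) * wlen Cl sC Wl sW (l + 1) (S l) X) ∧
      |Wprime Cl sC Wl sW S X| ≤ ε ^ m * K579 (NC * Nw) (ε * (NC * Nw)) m * (s * X.card * Real.exp (-(κ * X.card))) := by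
  set D : ℝ := s * X.card * Real.exp (-(κ * X.card)) with hD
  have hD0 : 0 ≤ D := by positivity
  obtain ⟨hc, hcle⟩ := tsum_graded_majorant_le hε0 (mul_nonneg hNC0 hNw0) hρ m
  -- termwise domination
  have hterm : ∀ l : ℕ, |1 / (2 * ((l : ℝ) + 1)) * wlen Cl sC Wl sW (l + 1) (S l) X| ≤
      D * (ε ^ max m (l + 1) * (NC * Nw) ^ (l + 1) / (2 * ((l : ℝ) + 1))) := by
    intro l
    have h := abs_wlen_le_graded hCs hWs hs hκ deg hdeg hε0 hε1 wB hwB hWle hNC hNw l (S l) (hS l) X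
    rw [abs_mul, abs_of_pos (by positivity : (0 : ℝ) < 1 / (2 * ((l : ℝ) + 1)))]
    calc 1 / (2 * ((l : ℝ) + 1)) * |wlen Cl sC Wl sW (l + 1) (S l) X|
        ≤ 1 / (2 * ((l : ℝ) + 1)) * (s * X.card * (ε ^ max m (l + 1) * (Real.exp (-(κ * X.card)) * (NC * Nw) ^ (l + 1)))) :=
          mul_le_mul_of_nonneg_left h (by positivity)
      _ = D * (ε ^ max m (l + 1) * (NC * Nw) ^ (l + 1) / (2 * ((l : ℝ) + 1))) := by
          simp only [hD]; ring
  have hsum : Summable (fun l : ℕ => 1 / (2 * ((l : ℝ) + 1)) * wlen Cl sC Wl sW (l + 1) (S l) X) :=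
    Summable.of_norm_bounded (hc.mul_left D) (fun l => by rw [Real.norm_eq_abs]; exact hterm l)
  refine ⟨hsum, ?_⟩
  unfold Wprime
  calc |∑' l : ℕ, 1 / (2 * ((l : ℝ) + 1)) * wlen Cl sC Wl sW (l + 1) (S l) X|
      ≤ ∑' l : ℕ, |1 / (2 * ((l : ℝ) + 1)) * wlen Cl sC Wl sW (l + 1) (S l) X| := by
        have h := norm_tsum_le_tsum_norm hsum.norm
        simpa only [Real.norm_eq_abs] using h
    _ ≤ ∑' l : ℕ, D * (ε ^ max m (l + 1) * (NC * Nw) ^ (l + 1) / (2 * ((l : ℝ) + 1))) :=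
        hsum.abs.tsum_le_tsum hterm (hc.mul_left D)
    _ = D * ∑' l : ℕ, ε ^ max m (l + 1) * (NC * Nw) ^ (l + 1) / (2 * ((l : ℝ) + 1)) := tsum_mul_left
    _ ≤ D * (ε ^ m * K579 (NC * Nw) (ε * (NC * Nw)) m) := mul_le_mul_of_nonneg_left hcle hD0
    _ = ε ^ m * K579 (NC * Nw) (ε * (NC * Nw)) m * D := by ring

end Orders

/-! ## §6 The printed shape of the first inequality of (5.7.9) -/

section Printed

/- r16's `PolymerSys` carries its polymer type in `Type`; the cube type of this section is accordingly `ι₀ : Type`. -/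
variable {ι₀ : Type} [DecidableEq ι₀]
variable {cube : T → ι₀} {Cl : A → Matrix T T ℝ} {sC : A → Finset ι₀} {Wl : B → Matrix T T ℝ} {sW : B → Finset ι₀}

omit [DecidableEq A] [DecidableEq B] in
/-- **THE FIRST INEQUALITY OF (5.7.9), PRINTED SHAPE** — *"|W^{(j)′}(X)| ≤ e_j^{n̄+1−α} e^{−cr(e_k)|X|^−}
(r(e_k)L^{k−j})^d |X|"*: for the constructed `W′` (words of total `e_j`-order `≥ n̄+1` selected), with at most
`(r(e_k)L^{k−j})^d` sites per cube, decay rate `κ = c·r(e_k)` and `|X|^− = max{0,|X|−1}` (r16's `cardMinus`, by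
`e^{−κ|X|} ≤ e^{−κ|X|^−}`):  `|W′(X)| ≤ (ε^{n̄+1}K) · e^{−cr(e_k)|X|^−} · (r(e_k)L^{k−j})^d · |X|`.  The print's single exponent
`e_j^{n̄+1−α}` is the place of `ε^{n̄+1}K` (`ε = e_j`; `K` explicit, absorbing the field-bound sizes `θ` — generic-constant
convention, cf. GAPS G-C2-p36-03). [cite: BalabanImbrieJaffe1988, (5.7.9) p.291] -/
theorem abs_Wprime_le_printed
    (hCs : ∀ a x y, Cl a x y ≠ 0 → cube x ∈ sC a ∧ cube y ∈ sC a)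
    (hWs : ∀ b x y, Wl b x y ≠ 0 → cube x ∈ sW b ∧ cube y ∈ sW b)
    {rk Lkj c : ℝ} {d : ℕ} (hcrk : 0 ≤ c * rk)
    {s : ℕ} (hs : ∀ cb : ι₀, (Finset.univ.filter fun x => cube x = cb).card ≤ s) (hsd : (s : ℝ) ≤ (rk * Lkj) ^ d)
    (deg : B → ℕ) (hdeg : ∀ b, 1 ≤ deg b) {ε : ℝ} (hε0 : 0 ≤ ε) (hε1 : ε ≤ 1)
    (wB : B → ℝ) (hwB : ∀ b, 0 ≤ wB b) (hWle : ∀ b, ‖Wl b‖ ≤ ε ^ deg b * wB b) {NC Nw : ℝ} (hNC0 : 0 ≤ NC) (hNw0 : 0 ≤ Nw)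
    (hNC : ∀ cb : ι₀, ∑ a, (if cb ∈ sC a then ‖Cl a‖ * Real.exp (c * rk * (sC a).card) * (sC a).card else 0) ≤ NC)
    (hNw : ∀ cb : ι₀, ∑ b, (if cb ∈ sW b then wB b * Real.exp (c * rk * (sW b).card) * (sW b).card else 0) ≤ Nw)
    (hρ : ε * (NC * Nw) < 1) (nbar : ℕ)
    (S : (l : ℕ) → (Fin (l + 1) → A × B) → Prop) [∀ l, DecidablePred (S l)]
    (hS : ∀ l w, S l w → nbar + 1 ≤ ∑ i, deg (w i).2) (X : Finset ι₀) :
    |Wprime Cl sC Wl sW S X| ≤ (ε ^ (nbar + 1) * K579 (NC * Nw) (ε * (NC * Nw)) (nbar + 1)) *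
      Real.exp (-(c * rk) * (cubePolymers ι₀).cardMinus X) * (rk * Lkj) ^ d * (cubePolymers ι₀).card X := by
  have h := (summable_Wprime hCs hWs hs hcrk deg hdeg hε0 hε1 wB hwB hWle hNC0 hNw0 hNC hNw hρ S hS X).2
  have hK : 0 ≤ ε ^ (nbar + 1) * K579 (NC * Nw) (ε * (NC * Nw)) (nbar + 1) :=
    mul_nonneg (pow_nonneg hε0 _) (K579_nonneg (mul_nonneg hNC0 hNw0) (by positivity) hρ _)
  have hexp : Real.exp (-(c * rk * X.card)) ≤ Real.exp (-(c * rk) * (cubePolymers ι₀).cardMinus X) := by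
    have h' := (cubePolymers ι₀).exp_card_le_exp_cardMinus hcrk X
    simpa [cubePolymers, neg_mul] using h'
  calc |Wprime Cl sC Wl sW S X|
      ≤ ε ^ (nbar + 1) * K579 (NC * Nw) (ε * (NC * Nw)) (nbar + 1) * (s * X.card * Real.exp (-(c * rk * X.card))) := h
    _ ≤ ε ^ (nbar + 1) * K579 (NC * Nw) (ε * (NC * Nw)) (nbar + 1) *
          ((rk * Lkj) ^ d * X.card * Real.exp (-(c * rk) * (cubePolymers ι₀).cardMinus X)) := by
        refine mul_le_mul_of_nonneg_left ?_ hK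
        exact mul_le_mul (mul_le_mul_of_nonneg_right hsd (Nat.cast_nonneg _)) hexp (Real.exp_nonneg _)
          (mul_nonneg (le_trans (Nat.cast_nonneg s) hsd) (Nat.cast_nonneg _))
    _ = (ε ^ (nbar + 1) * K579 (NC * Nw) (ε * (NC * Nw)) (nbar + 1)) *
          Real.exp (-(c * rk) * (cubePolymers ι₀).cardMinus X) * (rk * Lkj) ^ d * (cubePolymers ι₀).card X := by
        simp only [cubePolymers]; ring

omit [DecidableEq A] [DecidableEq B] in
/-- **(5.7.9), FIRST INEQUALITY, AS TYPED BY r16** — under the constants hypothesis `ε^{n̄+1}K ≤ e_j^{n̄+1−α}` (the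
identification of the explicit constant with the print's generic exponent), the constructed `W′` satisfies, for every
cube set `X`, `|W′ X| ≤ e_j^{n̄+1−α}·e^{−cr(e_k)|X|^−}·(r(e_k)L^{k−j})^d·|X|` — verbatim the FIRST CONJUNCT of
`BIJ88Sect5StatementsPart2.Ineq579 (cubePolymers ι₀) W′ ej rk Lkj d nbar α κ c` (its second conjunct, refuted as typed on
unbounded systems, is the subject of p36's `BIJ88Ineq579Second`). [cite: BalabanImbrieJaffe1988, (5.7.9) p.291] -/
theorem ineq579_first
    (hCs : ∀ a x y, Cl a x y ≠ 0 → cube x ∈ sC a ∧ cube y ∈ sC a)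
    (hWs : ∀ b x y, Wl b x y ≠ 0 → cube x ∈ sW b ∧ cube y ∈ sW b)
    {rk Lkj c : ℝ} {d : ℕ} (hcrk : 0 ≤ c * rk)
    {s : ℕ} (hs : ∀ cb : ι₀, (Finset.univ.filter fun x => cube x = cb).card ≤ s) (hsd : (s : ℝ) ≤ (rk * Lkj) ^ d)
    (deg : B → ℕ) (hdeg : ∀ b, 1 ≤ deg b) {ε : ℝ} (hε0 : 0 ≤ ε) (hε1 : ε ≤ 1)
    (wB : B → ℝ) (hwB : ∀ b, 0 ≤ wB b) (hWle : ∀ b, ‖Wl b‖ ≤ ε ^ deg b * wB b) {NC Nw : ℝ} (hNC0 : 0 ≤ NC) (hNw0 : 0 ≤ Nw)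
    (hNC : ∀ cb : ι₀, ∑ a, (if cb ∈ sC a then ‖Cl a‖ * Real.exp (c * rk * (sC a).card) * (sC a).card else 0) ≤ NC)
    (hNw : ∀ cb : ι₀, ∑ b, (if cb ∈ sW b then wB b * Real.exp (c * rk * (sW b).card) * (sW b).card else 0) ≤ Nw)
    (hρ : ε * (NC * Nw) < 1) (nbar : ℕ)
    (S : (l : ℕ) → (Fin (l + 1) → A × B) → Prop) [∀ l, DecidablePred (S l)]
    (hS : ∀ l w, S l w → nbar + 1 ≤ ∑ i, deg (w i).2)
    {ej α : ℝ} (hconst : ε ^ (nbar + 1) * K579 (NC * Nw) (ε * (NC * Nw)) (nbar + 1) ≤ ej ^ ((nbar : ℝ) + 1 - α))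
    (X : Finset ι₀) :
    |Wprime Cl sC Wl sW S X| ≤ ej ^ ((nbar : ℝ) + 1 - α) *
      Real.exp (-(c * rk) * (cubePolymers ι₀).cardMinus X) * (rk * Lkj) ^ d * (cubePolymers ι₀).card X := by
  refine (abs_Wprime_le_printed hCs hWs hcrk hs hsd deg hdeg hε0 hε1 wB hwB hWle hNC0 hNw0 hNC hNw hρ nbar S hS X).trans ?_
  have hrest : 0 ≤ Real.exp (-(c * rk) * (cubePolymers ι₀).cardMinus X) * (rk * Lkj) ^ d * (cubePolymers ι₀).card X := by
    have : (0 : ℝ) ≤ (rk * Lkj) ^ d := le_trans (Nat.cast_nonneg s) hsd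
    exact mul_nonneg (mul_nonneg (Real.exp_nonneg _) this) (Nat.cast_nonneg _)
  calc (ε ^ (nbar + 1) * K579 (NC * Nw) (ε * (NC * Nw)) (nbar + 1)) *
        Real.exp (-(c * rk) * (cubePolymers ι₀).cardMinus X) * (rk * Lkj) ^ d * (cubePolymers ι₀).card X
      = (ε ^ (nbar + 1) * K579 (NC * Nw) (ε * (NC * Nw)) (nbar + 1)) *
        (Real.exp (-(c * rk) * (cubePolymers ι₀).cardMinus X) * (rk * Lkj) ^ d * (cubePolymers ι₀).card X) := by ring
    _ ≤ ej ^ ((nbar : ℝ) + 1 - α) *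
        (Real.exp (-(c * rk) * (cubePolymers ι₀).cardMinus X) * (rk * Lkj) ^ d * (cubePolymers ι₀).card X) :=
        mul_le_mul_of_nonneg_right hconst hrest
    _ = ej ^ ((nbar : ℝ) + 1 - α) *
        Real.exp (-(c * rk) * (cubePolymers ι₀).cardMinus X) * (rk * Lkj) ^ d * (cubePolymers ι₀).card X := by ring

end Printed

/-! ## §7 The exponent of (5.7.4), localized -/

section Knitting

variable (Cl : A → Matrix T T ℝ) (sC : A → Finset ι) (Wl : B → Matrix T T ℝ) (sW : B → Finset ι)

omit [DecidableEq A] [DecidableEq B] in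
/-- **THE EXPONENT OF (5.7.4) IS `Σ_X W^{(j)′}(X)` PLUS THE LOW-ORDER TERMS** — with every word of length `> n̄` selected
(`S l` holds for `l ≥ n̄`) and every `W′(X)` series summable (e.g. by `summable_Wprime`), the series of (5.7.4) with both
expansions inserted equals `Σ_X W′(X) + Σ_{l ≤ n̄} (1/2l) Σ_X wlen l (¬S) X`, the second sum being the finitely many
unselected terms *"of order ≤ n̄ in e_j … treated carefully by a resummation"* (not analysed here).  The left side is the
series of p02's `BIJ88TraceLog574.hasSum_eq574` for `C = Σ_a C_a`, `W = Σ_b W_b`.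
[cite: BalabanImbrieJaffe1988, (5.7.4) p.289, (5.7.9) p.291] -/
theorem tsum_trace_terms_eq (S : (l : ℕ) → (Fin (l + 1) → A × B) → Prop) [∀ l, DecidablePred (S l)] (nbar : ℕ)
    (hS : ∀ l, nbar ≤ l → ∀ w, S l w)
    (hsum : ∀ X : Finset ι, Summable (fun l : ℕ => 1 / (2 * ((l : ℝ) + 1)) * wlen Cl sC Wl sW (l + 1) (S l) X)) :
    ∑' l : ℕ, 1 / (2 * ((l : ℝ) + 1)) * ((((∑ a, Cl a) * (∑ b, Wl b)) ^ (l + 1)).trace) =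
      ∑ X : Finset ι, Wprime Cl sC Wl sW S X +
        ∑ l ∈ Finset.range nbar, ∑ X : Finset ι,
          1 / (2 * ((l : ℝ) + 1)) * wlen Cl sC Wl sW (l + 1) (fun w => ¬ S l w) X := by
  classical
  set g : ℕ → ℝ := fun l => ∑ X : Finset ι, 1 / (2 * ((l : ℝ) + 1)) * wlen Cl sC Wl sW (l + 1) (S l) X with hg
  set h : ℕ → ℝ := fun l => ∑ X : Finset ι, 1 / (2 * ((l : ℝ) + 1)) * wlen Cl sC Wl sW (l + 1) (fun w => ¬ S l w) X
    with hh
  have hsplit : ∀ l : ℕ, 1 / (2 * ((l : ℝ) + 1)) * ((((∑ a, Cl a) * (∑ b, Wl b)) ^ (l + 1)).trace) = g l + h l :=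
    fun l => trace_term_eq_sum_wlen_add Cl sC Wl sW (l + 1) (S l) _
  have hzero : ∀ l ∉ Finset.range nbar, h l = 0 := by
    intro l hl
    rw [Finset.mem_range, not_lt] at hl
    simp only [hh]
    refine Finset.sum_eq_zero fun X _ => ?_
    rw [wlen, Finset.sum_eq_zero fun w hw => ?_, mul_zero]
    rw [Finset.mem_filter] at hw
    exact absurd (hS l hl w) hw.2.2
  have hgs : Summable g := summable_sum fun X _ => hsum X
  have hhs : Summable h := summable_of_ne_finset_zero hzero
  rw [tsum_congr hsplit, hgs.tsum_add hhs, tsum_eq_sum hzero, hg, Summable.tsum_finsetSum fun X _ => hsum X]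
  rfl

end Knitting

/-! ## Non-vacuity -/

/-- The hypotheses of `abs_wlen_le` are met non-trivially: one cube with one site (`T = ι = Unit`, `s = 1`), one
`C`-letter and one `W`-letter equal to the `1×1` kernel `1` with support the cube (rooted sums `N₀(C) = N₀(W) = 1` at
`κ = 0`): the bound reads `|wlen 1 ⊤ {()}| ≤ 1·1·(e^0·(1·1)^1)`, and indeed `wlen 1 ⊤ {()} = tr(1·1) = 1`. -/
example : |wlen (fun _ : Unit => (1 : Matrix Unit Unit ℝ)) (fun _ => {()}) (fun _ : Unit => (1 : Matrix Unit Unit ℝ))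
      (fun _ => {()}) 1 (fun _ => True) {()}| ≤
    (1 : ℕ) * ({()} : Finset Unit).card * (Real.exp (-(0 * ({()} : Finset Unit).card)) * (1 * 1) ^ (0 + 1)) := by
  refine abs_wlen_le (cube := fun _ : Unit => ()) (fun a x y _ => ⟨Finset.mem_singleton_self _, Finset.mem_singleton_self _⟩)
    (fun b x y _ => ⟨Finset.mem_singleton_self _, Finset.mem_singleton_self _⟩) (s := 1) (fun c => by simp) le_rfl
    (NC := 1) (NW := 1) (fun c => ?_) (fun c => ?_) 0 (fun _ => True) {()}
  all_goals
    have h1 : ‖(1 : Matrix Unit Unit ℝ)‖ = 1 := norm_one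
    simp [h1]

/-! ## §8 (v1.1) The printed chain of (5.7.9): both inequalities for the constructed `W′` -/

section Chain

open BIJ88Sect2Statements (rLen eK)

variable {ι₀ : Type} [DecidableEq ι₀]
variable {cube : T → ι₀} {Cl : A → Matrix T T ℝ} {sC : A → Finset ι₀} {Wl : B → Matrix T T ℝ} {sW : B → Finset ι₀}

omit [DecidableEq A] [DecidableEq B] in
/-- **(5.7.9), THE WHOLE PRINTED CHAIN FOR THE CONSTRUCTED `W′`** — *"|W^{(j)′}(X)| ≤ e_j^{n̄+1−α} e^{−cr(e_k)|X|^−}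
(r(e_k)L^{k−j})^d |X| ≤ e_j^κ e^{−cr(e_k)|X|^−}. (5.7.9) We can take κ arbitrarily large by increasing n̄."*: the first inequality
(`ineq579_first`, this file) at the running charges `e_j = eK L ε e₀ d j`, `r(e_k) = rLen r (eK L ε e₀ d k)` of r18's (2.2)/(2.3) and
`L^{k−j}`, followed by p36's second inequality `BIJ88Ineq579Second.ineq579_second` (generic-constant reading: second rate `c/2`,
`κ = n̄ + 1 − α − 2d/(4−d) − θ` explicit, regime `L > 1`, `d < 4`, `e_k ≤ 1`, `(c/2)r(e_k) ≥ 1`, `r(e_k)^d ≤ e_k^{−θ}`); the empty cube set,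
where p36's `|X| ≥ 1` does not apply, has `W′(∅) = 0` by the first inequality itself.  So, for every cube set `X`,
`|W′(X)| ≤ e_j^κ · e^{−(c/2)r(e_k)|X|^−}`. [cite: BalabanImbrieJaffe1988, (5.7.9) p.291] -/
theorem ineq579_chain
    (hCs : ∀ a x y, Cl a x y ≠ 0 → cube x ∈ sC a ∧ cube y ∈ sC a)
    (hWs : ∀ b x y, Wl b x y ≠ 0 → cube x ∈ sW b ∧ cube y ∈ sW b)
    {L e ε₀ r c θ α : ℝ} {d j k nbar : ℕ} (hL : 1 < L) (he : 0 < e) (hε₀ : 0 < ε₀) (hd : d < 4) (hj : j ≤ k)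
    (hek1 : eK L e ε₀ d k ≤ 1) (hθ : 0 < θ) (hc : 1 ≤ c / 2 * rLen r (eK L e ε₀ d k))
    (hpoly : rLen r (eK L e ε₀ d k) ^ d ≤ eK L e ε₀ d k ^ (-θ))
    {s : ℕ} (hs : ∀ cb : ι₀, (Finset.univ.filter fun x => cube x = cb).card ≤ s)
    (hsd : (s : ℝ) ≤ (rLen r (eK L e ε₀ d k) * L ^ (k - j)) ^ d)
    (deg : B → ℕ) (hdeg : ∀ b, 1 ≤ deg b) {ε : ℝ} (hε0 : 0 ≤ ε) (hε1 : ε ≤ 1)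
    (wB : B → ℝ) (hwB : ∀ b, 0 ≤ wB b) (hWle : ∀ b, ‖Wl b‖ ≤ ε ^ deg b * wB b) {NC Nw : ℝ} (hNC0 : 0 ≤ NC) (hNw0 : 0 ≤ Nw)
    (hNC : ∀ cb : ι₀, ∑ a, (if cb ∈ sC a then ‖Cl a‖ * Real.exp (c * rLen r (eK L e ε₀ d k) * (sC a).card) * (sC a).card
      else 0) ≤ NC)
    (hNw : ∀ cb : ι₀, ∑ b, (if cb ∈ sW b then wB b * Real.exp (c * rLen r (eK L e ε₀ d k) * (sW b).card) * (sW b).card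
      else 0) ≤ Nw)
    (hρ : ε * (NC * Nw) < 1)
    (S : (l : ℕ) → (Fin (l + 1) → A × B) → Prop) [∀ l, DecidablePred (S l)]
    (hS : ∀ l w, S l w → nbar + 1 ≤ ∑ i, deg (w i).2)
    (hconst : ε ^ (nbar + 1) * K579 (NC * Nw) (ε * (NC * Nw)) (nbar + 1) ≤ eK L e ε₀ d j ^ ((nbar : ℝ) + 1 - α))
    (X : Finset ι₀) :
    |Wprime Cl sC Wl sW S X| ≤ eK L e ε₀ d j ^ ((nbar : ℝ) + 1 - α - 2 * (d : ℝ) / (4 - (d : ℝ)) - θ) *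
      Real.exp (-(c / 2 * rLen r (eK L e ε₀ d k)) * (cubePolymers ι₀).cardMinus X) := by
  have hrk0 : 0 ≤ rLen r (eK L e ε₀ d k) := by unfold rLen; exact Real.rpow_nonneg (abs_nonneg _) _
  have hcrk : 0 ≤ c * rLen r (eK L e ε₀ d k) := by nlinarith
  have hfirst := ineq579_first hCs hWs hcrk hs hsd deg hdeg hε0 hε1 wB hwB hWle hNC0 hNw0 hNC hNw hρ nbar S hS hconst X
  rcases X.eq_empty_or_nonempty with rfl | hX
  · have h0 : |Wprime Cl sC Wl sW S (∅ : Finset ι₀)| ≤ 0 := by simpa [cubePolymers] using hfirst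
    refine h0.trans (mul_nonneg (Real.rpow_nonneg (BIJ88ScaleSums.eK_pos (by linarith) he hε₀ j).le _) (Real.exp_nonneg _))
  · have hcard : 1 ≤ (cubePolymers ι₀).card X := Finset.card_pos.2 hX
    exact hfirst.trans (BIJ88Ineq579Second.ineq579_second (cubePolymers ι₀) hL he hε₀ hd hj hek1 hθ hc hpoly hcard)

end Chain

/-! ## §9 (v1.2) The rooted-sum hypotheses discharged from the decay of the pieces -/

section Decay

variable {ι₀ : Type} [Fintype ι₀] [DecidableEq ι₀]
variable {cube : T → ι₀} {Cl : A → Matrix T T ℝ} {sC : A → Finset ι₀} {Wl : B → Matrix T T ℝ} {sW : B → Finset ι₀}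

omit [DecidableEq A] [DecidableEq B] in
/-- **THE FIRST INEQUALITY OF (5.7.9) FROM THE DECAY OF THE PIECES** — the printed inputs in their printed shapes: the `C`-pieces
supported in `R`-connected cube sets with aggregate decay `Σ_{a : sC a = X} ‖C_a‖ ≤ K_C·λ_C^{|X|}` ((2.46): *"|C^{(k)}_{Λ,X}(u;x₁,x₂)| ≤
e^{−c|x₁−x₂|}e^{−cr(e_k)|X|}"*, boundedly many pieces per support), the `W`-pieces likewise with `e_j`-orders, `Σ_{b : sW b = X} w_b ≤
K_W·λ_W^{|X|}` ((5.7.7)-block: *"|W^{(j)}(X;x₁,x₂)| ≤ e_j^{n̄+1−α}e^{−cr(e_k)|X|^−}"*), a cube adjacency of degree `≤ Δ₀`, and the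
decay strong enough for the rate `κ = c·r(e_k)` extracted: `(Δ₀+1)²·2λe^{κ} ≤ ½` for both families (`λ = e^{−c′r(e_k)}` with `c′ > c`
suffices) — THEN, with `N_C = 4K_Cλ_Ce^κ`, `N_w = 4K_Wλ_We^κ` (`BIJ88TraceTermsBound579.rooted_sum_le_of_decay`) and
`ρ = ε·N_CN_w < 1`:  `|W′(X)| ≤ (ε^{n̄+1}K)·e^{−cr(e_k)|X|^−}·(r(e_k)L^{k−j})^d·|X|` for every cube set `X`.
[cite: BalabanImbrieJaffe1988, (2.46) p.265, (5.7.9) p.291] -/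
theorem abs_Wprime_le_of_decay
    (hCs : ∀ a x y, Cl a x y ≠ 0 → cube x ∈ sC a ∧ cube y ∈ sC a)
    (hWs : ∀ b x y, Wl b x y ≠ 0 → cube x ∈ sW b ∧ cube y ∈ sW b)
    (R : ι₀ → ι₀ → Prop) (hR : ∀ x y, R x y → R y x) (nbr : ι₀ → Finset ι₀) {Δ₀ : ℕ}
    (hΔ₀ : ∀ x, (nbr x).card ≤ Δ₀) (hnbr : ∀ x y, R x y → y ∈ nbr x)
    {rk Lkj c : ℝ} {d : ℕ} (hcrk : 0 ≤ c * rk)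
    {s : ℕ} (hs : ∀ cb : ι₀, (Finset.univ.filter fun x => cube x = cb).card ≤ s) (hsd : (s : ℝ) ≤ (rk * Lkj) ^ d)
    (deg : B → ℕ) (hdeg : ∀ b, 1 ≤ deg b) {ε : ℝ} (hε0 : 0 ≤ ε) (hε1 : ε ≤ 1)
    (wB : B → ℝ) (hwB : ∀ b, 0 ≤ wB b) (hWle : ∀ b, ‖Wl b‖ ≤ ε ^ deg b * wB b)
    (hCconn : ∀ a, Cl a ≠ 0 → IsRConnected R (sC a)) (hWconn : ∀ b, wB b ≠ 0 → IsRConnected R (sW b))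
    {KC lamC KW lamW : ℝ} (hKC : 0 ≤ KC) (hlamC : 0 ≤ lamC) (hKW : 0 ≤ KW) (hlamW : 0 ≤ lamW)
    (haggC : ∀ X : Finset ι₀, ∑ a ∈ Finset.univ.filter (fun a => sC a = X), ‖Cl a‖ ≤ KC * lamC ^ X.card)
    (haggW : ∀ X : Finset ι₀, ∑ b ∈ Finset.univ.filter (fun b => sW b = X), wB b ≤ KW * lamW ^ X.card)
    (hsmallC : ((Δ₀ : ℝ) + 1) ^ 2 * (2 * (lamC * Real.exp (c * rk))) ≤ 1 / 2)
    (hsmallW : ((Δ₀ : ℝ) + 1) ^ 2 * (2 * (lamW * Real.exp (c * rk))) ≤ 1 / 2)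
    (hρ : ε * ((4 * KC * (lamC * Real.exp (c * rk))) * (4 * KW * (lamW * Real.exp (c * rk)))) < 1) (nbar : ℕ)
    (S : (l : ℕ) → (Fin (l + 1) → A × B) → Prop) [∀ l, DecidablePred (S l)]
    (hS : ∀ l w, S l w → nbar + 1 ≤ ∑ i, deg (w i).2) (X : Finset ι₀) :
    |Wprime Cl sC Wl sW S X| ≤
      (ε ^ (nbar + 1) * K579 ((4 * KC * (lamC * Real.exp (c * rk))) * (4 * KW * (lamW * Real.exp (c * rk))))
        (ε * ((4 * KC * (lamC * Real.exp (c * rk))) * (4 * KW * (lamW * Real.exp (c * rk))))) (nbar + 1)) *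
      Real.exp (-(c * rk) * (cubePolymers ι₀).cardMinus X) * (rk * Lkj) ^ d * (cubePolymers ι₀).card X := by
  have hNC : ∀ cb : ι₀, ∑ a, (if cb ∈ sC a then ‖Cl a‖ * Real.exp (c * rk * (sC a).card) * (sC a).card else 0) ≤
      4 * KC * (lamC * Real.exp (c * rk)) := fun cb =>
    BIJ88TraceTermsBound579.rooted_sum_le_of_decay R hR nbr hΔ₀ hnbr sC (u := fun a => ‖Cl a‖)
      (fun a ha => hCconn a (fun h => ha (by simp only [h, norm_zero]))) hKC hlamC haggC hsmallC cb
  have hNw : ∀ cb : ι₀, ∑ b, (if cb ∈ sW b then wB b * Real.exp (c * rk * (sW b).card) * (sW b).card else 0) ≤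
      4 * KW * (lamW * Real.exp (c * rk)) := fun cb =>
    BIJ88TraceTermsBound579.rooted_sum_le_of_decay R hR nbr hΔ₀ hnbr sW (u := wB) hWconn hKW hlamW haggW hsmallW cb
  exact abs_Wprime_le_printed hCs hWs hcrk hs hsd deg hdeg hε0 hε1 wB hwB hWle (by positivity) (by positivity) hNC hNw hρ
    nbar S hS X

end Decay

end Literature.MathematicalPhysics.QuantumFieldTheory.BalabanImbrieJaffe1984to88.BIJ88Ineq579First
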